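import Summits.CriticalPhenomena.PercolationContinuityZ3.Theorems.PercAnnulusCrossingIICLevelTwoSided
import HarnessLib

/-!
# Kesten–Basu–Sapozhnikov IIC scheme in boxes, XIX: the top level and the ratio algebra (lane RSW3, p1 gen 3)

builds on p205010 (kernel theorem, internal audit signed; external expert review pending)

Seat `prim-rsw3-p1` (gen 3); LANE-4 blueprint, memo `run/shared/lean/prim/rsw3/P1-QM.md` §13.4 step (4).  Helper file; no definitions, no
sorries.  The top level of the scheme decomposes `P(E ∩ {0 ↔ ∂ⁱⁿΛ(N)})` for a cylinder event `E` over the data `C` of the innermost annulus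
`(2M₁, 2M₂)` with weights `w_E(C) = P(E ∩ DAT(C) ∩ LINK'(C) ∩ LEFT(∅,{0};C))`: `S_E(N) = Σ_C w_E(C) γ_N(C)`.
* `conn_empty_zero_eq` — `CONN(∅,{0};N) = {0 ↔ ∂ⁱⁿΛ(N)}`;
* **`top_two_sided`** — `S_E(N) ≤ P(E ∩ {0 ↔ ∂ⁱⁿΛ(N)}) ≤ S_E(N) + ϰ⁻² α(2M₁,2M₂) π(N)` (part VII with `H = ∅`, `X = {0}`);
* `sum_mul_sum_le_of_osc` — termwise oscillation bound ⇒ `S_E(n) S(n') ≤ Q · S_E(n') S(n)`;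
* `abs_div_sub_div_le_of_two_sided` — the real-number endgame: two-sided sums with relative junk `η` and cross inequalities with constant `Q`
  give `|V/π − V'/π'| ≤ 2η + (Q − 1)`.
References: H. Kesten, PTRF 73 (1986) §2 (proof of Thm. (3)); D. Basu, A. Sapozhnikov, ECP 22 (2017) no. 26, §2.
-/

noncomputable section

namespace Summit.CriticalPhenomena.PercolationContinuityZ3.Theorems.Crossing

open MeasureTheory Literature.Probability.Percolation Literature.Probability.LatticeModels
open Literature.Probability.Percolation.DCT16
open Summit.CriticalPhenomena.PercolationContinuityZ3.Theorems.SurfaceTension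
open scoped Literature.Probability.Percolation

variable {d : ℕ}

/-- `CONN(∅,{0};N)` is the one-arm event `{0 ↔ ∂ⁱⁿΛ(N)}`. [folklore] -/
theorem conn_empty_zero_eq (N : ℕ) :
    {ω : BondConfig (Site d) | ∃ x ∈ ({0} : Finset (Site d)), ∃ t ∈ innerBoundary (zdGraph d) (box d N),
            ω ∈ openConnIn ((↑(box d N) : Set (Site d)) \ ↑(∅ : Finset (Site d))) x t} = siteToBoundary d N := by
  ext ω
  simp only [Set.mem_setOf_eq, Finset.mem_singleton, exists_eq_left, Finset.coe_empty, Set.sdiff_empty, siteToBoundary]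

/-- **The top level, two-sided**: for `E` determined by `F' ⊆ Λ(2M₁).sym2`, `1 ≤ M₁`, `4M₁ < 2M₂`, `4M₂ < N`:
`S_E(N) ≤ P(E ∩ {0 ↔ ∂ⁱⁿΛ(N)}) ≤ S_E(N) + ϰ⁻² α(2M₁,2M₂) π_p(N)`. [cite: Kesten1986, §2 eq. (22)] [cite: BasuSapozhnikov2017ECP, §2 (2.5)] -/
theorem top_two_sided (p : unitInterval) {ϰ : ℝ} (hϰ : 0 < ϰ)
    (hA2 : ∀ m : ℕ, 1 ≤ m → ∀ Z : Finset (Site d), box d (4 * m) \ box d (m - 1) ⊆ Z →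
      ∀ X : Finset (Site d), X ⊆ Z ∩ box d m → ∀ Y : Finset (Site d), Y ⊆ Z \ box d (4 * m) →
        ϰ * (bondPercolation (zdGraph d) p).real {ω | ∃ x ∈ X, ∃ s ∈ innerBoundary (zdGraph d) (box d (2 * m)),
              ω ∈ openConnIn (↑Z : Set (Site d)) x s} *
          (bondPercolation (zdGraph d) p).real {ω | ∃ y ∈ Y, ∃ s ∈ innerBoundary (zdGraph d) (box d (2 * m)),
              ω ∈ openConnIn (↑Z : Set (Site d)) y s} ≤
        (bondPercolation (zdGraph d) p).real {ω | ∃ x ∈ X, ∃ y ∈ Y, ω ∈ openConnIn (↑Z : Set (Site d)) x y})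
    {M₁ M₂ N : ℕ} (hM₁ : 1 ≤ M₁) (h12 : 4 * M₁ < 2 * M₂) (hN : 4 * M₂ < N)
    {E : Set (BondConfig (Site d))} {F' : Finset (Sym2 (Site d))} (hE : DeterminedBy E ↑F') (hF' : F' ⊆ (box d (2 * M₁)).sym2) :
    ∑ C ∈ ((box d (2 * M₂)).powerset.filter (fun U => box d (2 * M₁) ⊆ U)) ×ˢ (box d (2 * M₂ + 1)).powerset,
        (bondPercolation (zdGraph d) p).real (E ∩
          {ω : BondConfig (Site d) | ω ∩ (↑((box d (2 * M₂ + 1)).sym2) : Set (Sym2 (Site d))) ∈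
            explEvent (↑(box d (2 * M₁)) : Set (Site d)) ((↑(box d (2 * M₂)) : Set (Site d)) \ ↑(box d (2 * M₁))) ↑C.1 ↑C.2} ∩
          {ω : BondConfig (Site d) | ∀ r ∈ C.2, ∀ r' ∈ C.2, ∃ v ∈ C.1, ∃ v' ∈ C.1,
            s(v, r) ∈ ω ∧ s(v', r') ∈ ω ∧ ω ∈ openConnIn ((↑C.1 : Set (Site d)) \ ↑(box d (2 * M₁ - 1))) v v'} ∩
          {ω : BondConfig (Site d) | ∃ x ∈ ({0} : Finset (Site d)), ∃ r ∈ C.2, ∃ v ∈ C.1, ω ∈ openConnIn ((↑C.1 : Set (Site d)) \ ↑(∅ : Finset (Site d))) x v ∧ s(v, r) ∈ ω}) *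
        (bondPercolation (zdGraph d) p).real {ω : BondConfig (Site d) | ∃ x ∈ C.2, ∃ t ∈ innerBoundary (zdGraph d) (box d N),
            ω ∈ openConnIn ((↑(box d N) : Set (Site d)) \ ↑C.1) x t} ≤
      (bondPercolation (zdGraph d) p).real (E ∩ siteToBoundary d N) ∧
    (bondPercolation (zdGraph d) p).real (E ∩ siteToBoundary d N) ≤
      ∑ C ∈ ((box d (2 * M₂)).powerset.filter (fun U => box d (2 * M₁) ⊆ U)) ×ˢ (box d (2 * M₂ + 1)).powerset,
        (bondPercolation (zdGraph d) p).real (E ∩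
          {ω : BondConfig (Site d) | ω ∩ (↑((box d (2 * M₂ + 1)).sym2) : Set (Sym2 (Site d))) ∈
            explEvent (↑(box d (2 * M₁)) : Set (Site d)) ((↑(box d (2 * M₂)) : Set (Site d)) \ ↑(box d (2 * M₁))) ↑C.1 ↑C.2} ∩
          {ω : BondConfig (Site d) | ∀ r ∈ C.2, ∀ r' ∈ C.2, ∃ v ∈ C.1, ∃ v' ∈ C.1,
            s(v, r) ∈ ω ∧ s(v', r') ∈ ω ∧ ω ∈ openConnIn ((↑C.1 : Set (Site d)) \ ↑(box d (2 * M₁ - 1))) v v'} ∩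
          {ω : BondConfig (Site d) | ∃ x ∈ ({0} : Finset (Site d)), ∃ r ∈ C.2, ∃ v ∈ C.1, ω ∈ openConnIn ((↑C.1 : Set (Site d)) \ ↑(∅ : Finset (Site d))) x v ∧ s(v, r) ∈ ω}) *
        (bondPercolation (zdGraph d) p).real {ω : BondConfig (Site d) | ∃ x ∈ C.2, ∃ t ∈ innerBoundary (zdGraph d) (box d N),
            ω ∈ openConnIn ((↑(box d N) : Set (Site d)) \ ↑C.1) x t} +
      ϰ⁻¹ ^ 2 * (bondPercolation (zdGraph d) p).real (boxCrossing d (2 * M₁) (2 * M₂)) * oneArmProb d p N := by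
  classical
  have hX : ({0} : Finset (Site d)) ⊆ box d M₁ := Finset.singleton_subset_iff.2 (zero_mem_box d M₁)
  have h := sum_real_level_two_sided p hϰ hA2 hM₁ h12 hN (H := (∅ : Finset (Site d))) (X := ({0} : Finset (Site d)))
    (Finset.empty_subset _) hX (fun x _ => Finset.notMem_empty x) hE hF'
  rw [conn_empty_zero_eq] at h
  refine ⟨h.2, ?_⟩
  have : oneArmProb d p N = (bondPercolation (zdGraph d) p).real (siteToBoundary d N) := rfl
  rw [this]
  linarith [h.1]

/-- **Termwise oscillation bound ⇒ bound for the products of sums.** [cite: Kesten1986, §2 (25)] -/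
theorem sum_mul_sum_le_of_osc {κ : Type*} (s : Finset κ) {f g u v : κ → ℝ} {Q : ℝ} (hQ : 0 ≤ Q)
    (hf : ∀ C ∈ s, 0 ≤ f C) (hfg : ∀ C ∈ s, f C ≤ g C) (hu : ∀ C ∈ s, 0 ≤ u C) (hv : ∀ C ∈ s, 0 ≤ v C)
    (huv : ∀ C ∈ s, 0 < g C → 0 < v C → 0 < u C)
    (hosc : ∀ C ∈ s, ∀ C' ∈ s, 0 < g C → 0 < g C' → 0 < u C → 0 < u C' → u C * v C' ≤ Q * (u C' * v C)) :
    (∑ C ∈ s, f C * u C) * (∑ C ∈ s, g C * v C) ≤ Q * ((∑ C ∈ s, f C * v C) * (∑ C ∈ s, g C * u C)) := by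
  rw [Finset.sum_mul_sum, Finset.sum_mul_sum, Finset.mul_sum]
  refine Finset.sum_le_sum fun C hC => ?_
  rw [Finset.mul_sum]
  refine Finset.sum_le_sum fun C' hC' => ?_
  have hfC := hf C hC; have hgC' := (hf C' hC').trans (hfg C' hC'); have huC := hu C hC; have hvC' := hv C' hC'
  have huC' := hu C' hC'; have hvC := hv C hC
  have hR : 0 ≤ Q * (f C * v C * (g C' * u C')) := by positivity
  by_cases h0 : f C * u C * (g C' * v C') = 0
  · rw [h0]; exact hR
  have h1 : f C ≠ 0 := fun h => h0 (by rw [h]; ring)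
  have h2 : g C' ≠ 0 := fun h => h0 (by rw [h]; ring)
  have h3 : u C ≠ 0 := fun h => h0 (by rw [h]; ring)
  have h4 : v C' ≠ 0 := fun h => h0 (by rw [h]; ring)
  have hfC0 : 0 < f C := lt_of_le_of_ne hfC (Ne.symm h1)
  have hgC'0 : 0 < g C' := lt_of_le_of_ne hgC' (Ne.symm h2)
  have huC0 : 0 < u C := lt_of_le_of_ne huC (Ne.symm h3)
  have hvC'0 : 0 < v C' := lt_of_le_of_ne hvC' (Ne.symm h4)
  have huC'0 : 0 < u C' := huv C' hC' hgC'0 hvC'0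
  have key := hosc C hC C' hC' (lt_of_lt_of_le hfC0 (hfg C hC)) hgC'0 huC0 huC'0
  have := mul_le_mul_of_nonneg_left key (mul_nonneg hfC (hf C' hC' |>.trans (hfg C' hC')))
  calc f C * u C * (g C' * v C') = f C * g C' * (u C * v C') := by ring
    _ ≤ f C * g C' * (Q * (u C' * v C)) := this
    _ = Q * (f C * v C * (g C' * u C')) := by ring

/-- **The ratio endgame.**  `0 < π, π'`, `0 ≤ η < 1`, `1 ≤ Q`; `T ≤ π ≤ T + ηπ`, `S ≤ V ≤ S + ηπ`, `0 ≤ S ≤ T` (and primed); cross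
inequalities `S T' ≤ Q S' T`, `S' T ≤ Q S T'`.  Then `|V/π − V'/π'| ≤ 2η + (Q − 1)`. [cite: Kesten1986, §2 (proof of Thm. (3))] -/
theorem abs_div_sub_div_le_of_two_sided {V V' S S' T T' π π' η Q : ℝ} (hπ : 0 < π) (hπ' : 0 < π') (hη0 : 0 ≤ η) (hη1 : η < 1)
    (hQ : 1 ≤ Q) (hT : T ≤ π ∧ π ≤ T + η * π) (hT' : T' ≤ π' ∧ π' ≤ T' + η * π')
    (hS : S ≤ V ∧ V ≤ S + η * π) (hS' : S' ≤ V' ∧ V' ≤ S' + η * π')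
    (h0S : 0 ≤ S) (hST : S ≤ T) (h0S' : 0 ≤ S') (hST' : S' ≤ T')
    (hx1 : S * T' ≤ Q * (S' * T)) (hx2 : S' * T ≤ Q * (S * T')) :
    |V / π - V' / π'| ≤ 2 * η + (Q - 1) := by
  have hTpos : 0 < T := by nlinarith
  have hT'pos : 0 < T' := by nlinarith
  -- the clean ratios
  set ρ := S / T with hρ
  set ρ' := S' / T' with hρ'
  have hρ0 : 0 ≤ ρ := div_nonneg h0S hTpos.le
  have hρ1 : ρ ≤ 1 := (div_le_one hTpos).2 hST
  have hρ'0 : 0 ≤ ρ' := div_nonneg h0S' hT'pos.le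
  have hρ'1 : ρ' ≤ 1 := (div_le_one hT'pos).2 hST'
  -- `|V/π − ρ| ≤ η`
  have hup : V / π ≤ ρ + η := by
    have h1 : V / π ≤ (S + η * π) / π := div_le_div_of_nonneg_right hS.2 hπ.le
    have h2 : (S + η * π) / π = S / π + η := by field_simp
    have h3 : S / π ≤ S / T := div_le_div_of_nonneg_left h0S hTpos hT.1
    linarith
  have hlow : ρ - η ≤ V / π := by
    have h1 : S / π ≤ V / π := div_le_div_of_nonneg_right hS.1 hπ.le
    -- `S/π = ρ · (T/π) ≥ ρ (1 − η) ≥ ρ − η`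
    have h2 : (1 - η) * π ≤ T := by linarith [hT.2]
    have h3 : ρ * (1 - η) ≤ S / π := by
      rw [hρ, div_mul_eq_mul_div, div_le_div_iff₀ hTpos hπ]
      calc S * (1 - η) * π = S * ((1 - η) * π) := by ring
        _ ≤ S * T := mul_le_mul_of_nonneg_left h2 h0S
    nlinarith
  have hup' : V' / π' ≤ ρ' + η := by
    have h1 : V' / π' ≤ (S' + η * π') / π' := div_le_div_of_nonneg_right hS'.2 hπ'.le
    have h2 : (S' + η * π') / π' = S' / π' + η := by field_simp
    have h3 : S' / π' ≤ S' / T' := div_le_div_of_nonneg_left h0S' hT'pos hT'.1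
    linarith
  have hlow' : ρ' - η ≤ V' / π' := by
    have h1 : S' / π' ≤ V' / π' := div_le_div_of_nonneg_right hS'.1 hπ'.le
    have h2 : (1 - η) * π' ≤ T' := by linarith [hT'.2]
    have h3 : ρ' * (1 - η) ≤ S' / π' := by
      rw [hρ', div_mul_eq_mul_div, div_le_div_iff₀ hT'pos hπ']
      calc S' * (1 - η) * π' = S' * ((1 - η) * π') := by ring
        _ ≤ S' * T' := mul_le_mul_of_nonneg_left h2 h0S'
    nlinarith
  -- `ρ ≤ Q ρ'`, `ρ' ≤ Q ρ`
  have hcr : ρ ≤ Q * ρ' := by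
    rw [hρ, hρ', mul_div_assoc', div_le_div_iff₀ hTpos hT'pos]
    linarith
  have hcr' : ρ' ≤ Q * ρ := by
    rw [hρ, hρ', mul_div_assoc', div_le_div_iff₀ hT'pos hTpos]
    linarith
  rw [abs_sub_le_iff]
  constructor <;> nlinarith


end Summit.CriticalPhenomena.PercolationContinuityZ3.Theorems.Crossing

end
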